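import Summits.FinalStateConjecture.FinalStateConjecture.Theorems.BulkKerrCaptureC2.Negative.BlockForm
import HarnessLib

/-!
# Crux `PhaseMixingCapture.BulkKerrCaptureC2` (stmt-FinalStateConjecture-14985): the sub-extremality of the limit
# is NOT load-bearing — it is forced by the parameter clause

Support file for the crux `BulkKerrCaptureC2` (sub-extremal Kerr capture in the bulk, import grade, `C²` handed
over).  The conclusion of the crux asks, for every maximal vacuum Cauchy development, for SOME `(M', a')` with
(i) `Kerr.IsSubextremal M' a'`, (ii) far-completeness, (iii) `C²`-convergence of a region to `g_{M',a'}` and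
(iv) `|M' − M| + |a' − a| ≤ η`.  Since the centre `(M, a)` is itself sub-extremal with the UNIFORM margin
`|a| ≤ a₁ M`, `a₁ < 1`, and the tolerance `η` is quantified universally BEFORE the basin `ε`, conjunct (i) is
redundant: for `η ≤ (1 − a₁) M / 4` it follows from (iv) (`isSubextremal_of_near`), and the block is monotone in
`η`.  Hence:

* `isSubextremal_of_near` — `|a| ≤ a₁ M`, `a₁ < 1`, `0 < M`, `|M' − M| + |a' − a| ≤ η' ≤ (1 − a₁) M / 4` force
  `|a'| < M'`;
* `captureC2At_of_weak` — the block `CaptureC2At s δ M _ ε η a` follows from its version WITHOUT conjunct (i) at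
  any tolerance `η' ≤ min η ((1 − a₁) M / 4)`;
* `bulkKerrCaptureC2_iff_dropSubextremal` — **the crux is equivalent to the same statement with the conjunct
  `Kerr.IsSubextremal M' a'` deleted from the conclusion** (registered sub-goal
  `stub_bulkKerrCaptureC2_iff_dropSubextremal`).

So the load-bearing content of the conclusion is exactly: far-completeness, `C²`-convergence to SOME Kerr metric,
and `η`-closeness of its parameters to the centre.  Nothing here closes the crux.  Everything is proved; no
definitions, no named facts.  References: B. O'Neill, *The geometry of Kerr black holes* (1995), Ch. 2, §2.1 (the
sub-extremal range `|a| < M`); M. Dafermos, G. Holzegel, I. Rodnianski, M. Taylor, arXiv:2104.08222, §1 (the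
shape of asymptotic-stability statements: convergence to a NEARBY member of the family).
-/

-- the doubled `FinalStateConjecture.FinalStateConjecture` path component trips dupNamespace
set_option linter.dupNamespace false

noncomputable section

open Set Function Topology
open scoped Manifold ContDiff Topology ENNReal
open Literature.Geometry.Lorentzian
open Summit.FinalStateConjecture.FinalStateConjecture.Theses.PhaseMixingCapture (BulkKerrCaptureC2)
open Summit.FinalStateConjecture.FinalStateConjecture.Theorems.BulkKerrCaptureC2.Negative
  (CaptureC2At bulkKerrCaptureC2_iff_captureC2At)

namespace Summit.FinalStateConjecture.FinalStateConjecture.Theorems.BulkKerrCaptureC2.Prefix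

/-! ## §1 Closeness to a uniformly sub-extremal centre forces sub-extremality -/

/-- **Sub-extremality of the limit is forced by the parameter clause.**  If the centre `(M, a)` has the uniform
sub-extremality margin `|a| ≤ a₁ M` with `a₁ < 1`, `0 < M`, and `(M', a')` is within `η' ≤ (1 − a₁) M / 4` of it in
the `ℓ¹` sense, then `|a'| < M'`: indeed `|a'| ≤ |a| + η' − |M' − M| ≤ a₁ M + η' − (M − M') < M'` as
`2η' < (1 − a₁) M`.  O'Neill 1995, Ch. 2, §2.1 (the range `|a| < M`). [cite: ONeill1995, Ch. 2 §2.1] -/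
theorem isSubextremal_of_near {M a M' a' a₁ η' : ℝ} (hM : 0 < M) (ha₁ : a₁ < 1) (ha : |a| ≤ a₁ * M)
    (hη' : η' ≤ (1 - a₁) * M / 4) (h : |M' - M| + |a' - a| ≤ η') : Kerr.IsSubextremal M' a' := by
  unfold Kerr.IsSubextremal
  have h1 : |a'| - |a| ≤ |a' - a| := abs_sub_abs_le_abs_sub a' a
  have h2 : M - M' ≤ |M' - M| := by
    rw [abs_sub_comm]
    exact le_abs_self _
  have h3 : 0 < (1 - a₁) * M := mul_pos (by linarith) hM
  nlinarith

/-- The tolerance used below is positive: `0 < min η ((1 − a₁) M / 4)` for `0 < η`, `a₁ < 1`, `0 < M`. [folklore] -/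
theorem tolerance_pos {M a₁ η : ℝ} (hM : 0 < M) (ha₁ : a₁ < 1) (hη : 0 < η) :
    0 < min η ((1 - a₁) * M / 4) :=
  lt_min hη (by have h3 : 0 < (1 - a₁) * M := mul_pos (by linarith) hM; linarith)

/-! ## §2 The block without the sub-extremality conjunct -/

section Block

variable [Kerr.Facts] [Kerr.SliceFacts]

/-- **The block follows from its version without the sub-extremality conjunct, at a smaller tolerance.**  If every
admissible datum near `Kerr.data M a M` has all its maximal vacuum Cauchy developments far-complete with a region
converging in `C²` to SOME `g_{M',a'}` with `|M' − M| + |a' − a| ≤ η'`, where `η' ≤ η` and `η' ≤ (1 − a₁) M / 4`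
for a margin `|a| ≤ a₁ M`, `a₁ < 1`, then `CaptureC2At s δ M _ ε η a` holds: the limit parameters are automatically
sub-extremal (`isSubextremal_of_near`).  DHRT arXiv:2104.08222, §1 (convergence to a nearby member of the family).
[cite: arXiv210408222, §1] -/
theorem captureC2At_of_weak {s : ℕ} {δ M : ℝ} (hM : 0 < M) {ε η η' a a₁ : ℝ} (ha₁ : a₁ < 1)
    (ha : |a| ≤ a₁ * M) (hη'η : η' ≤ η) (hη' : η' ≤ (1 - a₁) * M / 4)
    (h : ∀ (D : InitialDataSet 𝓘(ℝ, E3) (Kerr.slice a M)) [D.metric.HasLeviCivita],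
      D.IsVacuumConstraintSolution →
      (∀ s' : ℕ, InitialDataSet.dataWeightedSobolevEDist s' δ D (Kerr.data M a M hM.le) < ⊤) →
      InitialDataSet.dataWeightedSobolevEDist s δ D (Kerr.data M a M hM.le) < ENNReal.ofReal ε →
      ∀ 𝒟 : VacuumCauchyDevelopment D, 𝒟.IsMaximal →
        ∃ (M' a' : ℝ) (𝒟oc : Set 𝒟.carrier),
          𝒟.HasCompleteFutureNullInfinityFar ∧
          𝒟.toSpacetime.ConvergesToKerr 𝒟oc M' a' 2 ∧ |M' - M| + |a' - a| ≤ η') :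
    CaptureC2At s δ M hM.le ε η a := by
  intro D _ hvac hcon hdist 𝒟 hmax
  obtain ⟨M', a', 𝒟oc, hfar, hconv, hpar⟩ := h D hvac hcon hdist 𝒟 hmax
  exact ⟨M', a', 𝒟oc, isSubextremal_of_near hM ha₁ ha hη' hpar, hfar, hconv, hpar.trans hη'η⟩

/-- Conversely (trivially), the block implies its version without the sub-extremality conjunct, at the same
tolerance. [folklore] -/
theorem weak_of_captureC2At {s : ℕ} {δ M : ℝ} {hM : 0 ≤ M} {ε η a : ℝ} (h : CaptureC2At s δ M hM ε η a) :
    ∀ (D : InitialDataSet 𝓘(ℝ, E3) (Kerr.slice a M)) [D.metric.HasLeviCivita],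
      D.IsVacuumConstraintSolution →
      (∀ s' : ℕ, InitialDataSet.dataWeightedSobolevEDist s' δ D (Kerr.data M a M hM) < ⊤) →
      InitialDataSet.dataWeightedSobolevEDist s δ D (Kerr.data M a M hM) < ENNReal.ofReal ε →
      ∀ 𝒟 : VacuumCauchyDevelopment D, 𝒟.IsMaximal →
        ∃ (M' a' : ℝ) (𝒟oc : Set 𝒟.carrier),
          𝒟.HasCompleteFutureNullInfinityFar ∧
          𝒟.toSpacetime.ConvergesToKerr 𝒟oc M' a' 2 ∧ |M' - M| + |a' - a| ≤ η := by
  intro D _ hvac hcon hdist 𝒟 hmax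
  obtain ⟨M', a', 𝒟oc, -, hfar, hconv, hpar⟩ := h D hvac hcon hdist 𝒟 hmax
  exact ⟨M', a', 𝒟oc, hfar, hconv, hpar⟩

end Block

/-! ## §3 The crux with the sub-extremality conjunct deleted -/

/-- **`BulkKerrCaptureC2` is equivalent to the same statement WITHOUT the conjunct `Kerr.IsSubextremal M' a'` in
its conclusion.**  Forward: delete the conjunct.  Backward: given `a₁ < 1`, the pair `(s, δ)` of the weak statement,
`M > 0` and `η > 0`, use the weak statement's basin `ε` for the tolerance `η' := min η ((1 − a₁) M / 4) > 0`; for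
`|a| ≤ a₁ M` the limit parameters it produces are within `η' ≤ η` of `(M, a)` and hence sub-extremal
(`captureC2At_of_weak`).  So the load-bearing content of the conclusion of the crux is far-completeness,
`C²`-convergence to SOME Kerr metric, and `η`-closeness of its parameters.  DHRT arXiv:2104.08222, §1; O'Neill
1995, Ch. 2, §2.1. [cite: arXiv210408222, §1] -/
theorem bulkKerrCaptureC2_iff_dropSubextremal :
    BulkKerrCaptureC2 ↔
      ∀ [Kerr.Facts] [Kerr.SliceFacts], ∀ a₁ : ℝ, a₁ < 1 → ∃ (s : ℕ) (δ : ℝ),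
        ∀ (M : ℝ) (hM : 0 < M), ∀ η > (0 : ℝ), ∃ ε > (0 : ℝ), ∀ a : ℝ, |a| ≤ a₁ * M →
          ∀ (D : InitialDataSet 𝓘(ℝ, E3) (Kerr.slice a M)) [D.metric.HasLeviCivita],
            D.IsVacuumConstraintSolution →
            (∀ s' : ℕ,
              InitialDataSet.dataWeightedSobolevEDist s' δ D (Kerr.data M a M hM.le) < ⊤) →
            InitialDataSet.dataWeightedSobolevEDist s δ D (Kerr.data M a M hM.le) <
              ENNReal.ofReal ε →
            ∀ 𝒟 : VacuumCauchyDevelopment D, 𝒟.IsMaximal →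
              ∃ (M' a' : ℝ) (𝒟oc : Set 𝒟.carrier),
                𝒟.HasCompleteFutureNullInfinityFar ∧
                𝒟.toSpacetime.ConvergesToKerr 𝒟oc M' a' 2 ∧ |M' - M| + |a' - a| ≤ η := by
  rw [bulkKerrCaptureC2_iff_captureC2At]
  constructor
  · intro h _ _ a₁ ha₁
    obtain ⟨s, δ, H⟩ := h a₁ ha₁
    refine ⟨s, δ, fun M hM η hη ↦ ?_⟩
    obtain ⟨ε, hε, Hε⟩ := H M hM η hη
    exact ⟨ε, hε, fun a ha ↦ weak_of_captureC2At (Hε a ha)⟩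
  · intro h _ _ a₁ ha₁
    obtain ⟨s, δ, H⟩ := h a₁ ha₁
    refine ⟨s, δ, fun M hM η hη ↦ ?_⟩
    obtain ⟨ε, hε, Hε⟩ := H M hM (min η ((1 - a₁) * M / 4)) (tolerance_pos hM ha₁ hη)
    exact ⟨ε, hε, fun a ha ↦ captureC2At_of_weak hM ha₁ ha (min_le_left _ _) (min_le_right _ _) (Hε a ha)⟩

/-- **Registered sub-goal `stub_bulkKerrCaptureC2_iff_dropSubextremal`** (crux item stmt-FinalStateConjecture-14985):
the crux is equivalent to the same statement with the conjunct `Kerr.IsSubextremal M' a'` deleted from its conclusion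
(closed form of `bulkKerrCaptureC2_iff_dropSubextremal`). [cite: arXiv210408222, §1] -/
theorem stub_bulkKerrCaptureC2_iff_dropSubextremal : BulkKerrCaptureC2 ↔ ∀ [Kerr.Facts] [Kerr.SliceFacts], ∀ a₁ : ℝ, a₁ < 1 → ∃ (s : ℕ) (δ : ℝ), ∀ (M : ℝ) (hM : 0 < M), ∀ η > (0 : ℝ), ∃ ε > (0 : ℝ), ∀ a : ℝ, |a| ≤ a₁ * M → ∀ (D : InitialDataSet 𝓘(ℝ, E3) (Kerr.slice a M)) [D.metric.HasLeviCivita], D.IsVacuumConstraintSolution → (∀ s' : ℕ, InitialDataSet.dataWeightedSobolevEDist s' δ D (Kerr.data M a M hM.le) < ⊤) → InitialDataSet.dataWeightedSobolevEDist s δ D (Kerr.data M a M hM.le) < ENNReal.ofReal ε → ∀ 𝒟 : VacuumCauchyDevelopment D, 𝒟.IsMaximal → ∃ (M' a' : ℝ) (𝒟oc : Set 𝒟.carrier), 𝒟.HasCompleteFutureNullInfinityFar ∧ 𝒟.toSpacetime.ConvergesToKerr 𝒟oc M' a' 2 ∧ |M' - M| + |a' - a| ≤ η :=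
  bulkKerrCaptureC2_iff_dropSubextremal

end Summit.FinalStateConjecture.FinalStateConjecture.Theorems.BulkKerrCaptureC2.Prefix

end
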